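import Summits.RiemannHypothesis.RiemannHypothesis.Theorems.WeilTwoPrimeDeflC83XBase
import Literature.NumberTheory.LFunctions.WeilBlockRowsFast
import HarnessLib

/-!
# Deflated two-prime certificate (weilCertDeflC83X): the Bessel block claim `Hp = C H Cᵀ` (parity 1), rows 0–4, fast check

`WeilCert.checkHpRowT` (linear traversals) instead of the indexed `checkHpRow` decide.  Pure proof file.
-/

set_option linter.dupNamespace false

noncomputable section

namespace Summit.RiemannHypothesis.RiemannHypothesis.Theorems.EvenWinsBeyondArch

open Literature.NumberTheory.LFunctions

set_option maxHeartbeats 0 in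
/-- Fast kernel check of claim row 0 of `Hp = C H Cᵀ` (parity 1; linear traversals, triangular `C`). [folklore] -/
theorem checkHpRowT1_0_weilCertDeflC83X : weilCertDeflC83XBase.checkHpRowT weilCertDeflC83XHpO 1 0 = true := by
  decide +kernel

/-- Claim row 0 of `Hp = C H Cᵀ` (parity 1), from the fast check. [folklore] -/
theorem checkHpRow1_0_weilCertDeflC83X : weilCertDeflC83XBase.checkHpRow weilCertDeflC83XHpO 1 0 = true :=
  WeilCert.checkHpRow_of_T checkHpRowT1_0_weilCertDeflC83X

set_option maxHeartbeats 0 in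
/-- Fast kernel check of claim row 1 of `Hp = C H Cᵀ` (parity 1; linear traversals, triangular `C`). [folklore] -/
theorem checkHpRowT1_1_weilCertDeflC83X : weilCertDeflC83XBase.checkHpRowT weilCertDeflC83XHpO 1 1 = true := by
  decide +kernel

/-- Claim row 1 of `Hp = C H Cᵀ` (parity 1), from the fast check. [folklore] -/
theorem checkHpRow1_1_weilCertDeflC83X : weilCertDeflC83XBase.checkHpRow weilCertDeflC83XHpO 1 1 = true :=
  WeilCert.checkHpRow_of_T checkHpRowT1_1_weilCertDeflC83X

set_option maxHeartbeats 0 in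
/-- Fast kernel check of claim row 2 of `Hp = C H Cᵀ` (parity 1; linear traversals, triangular `C`). [folklore] -/
theorem checkHpRowT1_2_weilCertDeflC83X : weilCertDeflC83XBase.checkHpRowT weilCertDeflC83XHpO 1 2 = true := by
  decide +kernel

/-- Claim row 2 of `Hp = C H Cᵀ` (parity 1), from the fast check. [folklore] -/
theorem checkHpRow1_2_weilCertDeflC83X : weilCertDeflC83XBase.checkHpRow weilCertDeflC83XHpO 1 2 = true :=
  WeilCert.checkHpRow_of_T checkHpRowT1_2_weilCertDeflC83X

set_option maxHeartbeats 0 in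
/-- Fast kernel check of claim row 3 of `Hp = C H Cᵀ` (parity 1; linear traversals, triangular `C`). [folklore] -/
theorem checkHpRowT1_3_weilCertDeflC83X : weilCertDeflC83XBase.checkHpRowT weilCertDeflC83XHpO 1 3 = true := by
  decide +kernel

/-- Claim row 3 of `Hp = C H Cᵀ` (parity 1), from the fast check. [folklore] -/
theorem checkHpRow1_3_weilCertDeflC83X : weilCertDeflC83XBase.checkHpRow weilCertDeflC83XHpO 1 3 = true :=
  WeilCert.checkHpRow_of_T checkHpRowT1_3_weilCertDeflC83X

set_option maxHeartbeats 0 in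
/-- Fast kernel check of claim row 4 of `Hp = C H Cᵀ` (parity 1; linear traversals, triangular `C`). [folklore] -/
theorem checkHpRowT1_4_weilCertDeflC83X : weilCertDeflC83XBase.checkHpRowT weilCertDeflC83XHpO 1 4 = true := by
  decide +kernel

/-- Claim row 4 of `Hp = C H Cᵀ` (parity 1), from the fast check. [folklore] -/
theorem checkHpRow1_4_weilCertDeflC83X : weilCertDeflC83XBase.checkHpRow weilCertDeflC83XHpO 1 4 = true :=
  WeilCert.checkHpRow_of_T checkHpRowT1_4_weilCertDeflC83X

end Summit.RiemannHypothesis.RiemannHypothesis.Theorems.EvenWinsBeyondArch
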